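import Mathlib
import HarnessLib
import Summits.HubbardSuperconductivity.HubbardSuperconductivity.Theorems.KLProgrammeKLRegimeSplitTwoLegTimeMomentFromGrid

/-!
# Route `KLProgramme` — K3 gen-7F (K3-FLOW RULING F, KL STATUS l.2548), engine-flow child, stub (M) at the BARE FRAME `K₀ = 0`: the grid→momentum
# bridge at EVERY derivative order, and its scale-`0`, frame-`0` instance with the representation discharged

Cell `gate-hubbard-kl`, seat p1b (g8).  Under the flowing-dispersion family the two-leg slot at scale `n` reads the ANGULAR JETS `k ≤ 4` of the
local part of the one-shot action at the flow frame `K_n` (p2's `TwoLegReadJetsF`); at scale `0` the frame is `K₀ = 0`, there is NO counterterm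
vertex and NO counterterm chain, and the global momentum sizes of the interpolated local self-energy `I_L[σ₀]` ARE the currency (my READ + PLAN line
of 2026-08-27 ≈10:45Z).  p1b g7's bridge `twoLeg_sep_momentumSizes_of_grid` (…TwoLegMomentsFromGrid, p504333) stops at `k ≤ 2` only because the V13 tier
did; the underlying moment lemma `norm_iteratedFDeriv_evalM_symInterp_le_offZero_moments` (…SymInterpPureMoments, p496957) is order-generic.  Here:

* `twoLeg_sep_momentumSizes_of_grid_all` — the p504333 bridge at every order `k`: plain pinned sum `B 0`, OFF-DIAGONAL `(1+|Δx̃₀|+|Δx̃₁|)ᵏ`-weighted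
  pinned sums `B k` (`k ≥ 1`) of the grid element's own two-leg kernel ⇒ `‖Dᵏ evalM (symInterp L (σ_n − K∘p))‖ ≤ (2|P|/(|β|L²))·B k`;
* `framePosKernel_frameZero`, `hubbardGridCounterQuadratic_frameZero` — the bare frame has no position kernel and no grid counterterm;
* `klEffectiveAction_zero_frameZero_eq_map_gridSub` — at `K = 0`: `𝒱⁽⁰⁾ = map S_{4M} (effAction (S_{4M}ᵀ C⁰_{>e₀} S_{4M}) V_{4M})` (p3's
  `klEffectiveAction_zero_sub_counterQuadratic_eq_map_gridSub` with both counterterms erased);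
* **`twoLeg_momentumSizes_zero_frameZero_of_grid`** — at `K = 0`, `n = 0`, for EVERY `k`:
  `‖Dᵏ evalM (symInterp L (klLocSelfEnergyRe … 0 0))‖ ≤ (2·|GridPoint L 4M|/(|β|L²))·B k` from the pinned sums of `kernel₂ (effAction (SᵀC⁰S) V_{4M})`
  (representation DISCHARGED; the vertex is the ultralocal quartic alone);
* **`abs_klFieldStrength_zero_frameZero_sub_one_le_of_grid_time_moment`** — the (E3d) twin at `K = 0` (p3's time-moment bridge with the vertex `V_{4M}`).

Proofs only; no definitions; nothing about the model's sizes is asserted.  References: BGM 2006 §2.1 (2.5), §2.3 (2.17), §3 (3.2)–(3.3)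
[cite: BenfattoGiulianiMastropietro2006].
-/

noncomputable section

namespace Summit.HubbardSuperconductivity.HubbardSuperconductivity.Theorems.TwoLegFourier

set_option linter.dupNamespace false -- summit = problem name (single-conjunct summit), D-0017

open Finset Complex
open Literature.MathematicalPhysics.QuantumLattice Literature.Probability.LatticeModels GrassmannAlgebra
open Summit.HubbardSuperconductivity.HubbardSuperconductivity.Theorems.KLRegimeSplit
open Summit.HubbardSuperconductivity.HubbardSuperconductivity.Theorems.KLProgrammeLegKernels
open Summit.HubbardSuperconductivity.HubbardSuperconductivity.Theorems.EngineV8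

variable {L M : ℕ} [NeZero L] {P : Type*} [Fintype P] [DecidableEq P]

/-! ## §1 The bridge at every derivative order -/

section Model

variable [NeZero M]

/-- **MOMENTUM-SIDE SIZES OF THE K-SEPARATED DATA FROM A GRID ELEMENT, EVERY ORDER**: if `𝒱⁽ⁿ⁾ − 𝒩_K = map S W` for a grid element `W`
(`S = gridSubMatrix β x τ`) whose two-leg kernels have pinned sums `≤ B 0` (weight `1`) and pinned OFF-DIAGONAL weighted sums `≤ B k`
(weight `[z ≠ 0](1+|z̃₀|+|z̃₁|)ᵏ`, every `k ≥ 1`), then for every `k`: `‖Dᵏ evalM (symInterp L (σ_n − K∘p))‖ ≤ (2|P|/(|β|L²))·B k`. -/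
theorem twoLeg_sep_momentumSizes_of_grid_all {β : ℝ} (hβ : β ≠ 0) (U μ : ℝ) (K : TrigPolyC4v) (n : ℕ) (x : P → TorusSite 2 L)
    (τ : P → ℝ) (W : GrassmannAlgebra ℂ (GridLeg P))
    (hW : klEffectiveAction L M β U μ K klE0 n - counterQuadratic L M β K =
      ExteriorAlgebra.map (Matrix.toLin' (gridSubMatrix L M β x τ)) W)
    {B : ℕ → ℝ}
    (hB0 : ∀ (σ : Fin 2) (p₀ : P), ∑ p₁ : P, ‖kernel ℂ W 2 (fun i => ((![p₀, p₁] i, σ), i))‖ ≤ B 0)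
    (hBk : ∀ k, 1 ≤ k → ∀ (σ : Fin 2) (p₀ : P), ∑ p₁ : P,
      (if x p₁ - x p₀ = 0 then (0 : ℝ) else
        (1 + (((x p₁ - x p₀) 0).valMinAbs.natAbs : ℝ) + (((x p₁ - x p₀) 1).valMinAbs.natAbs : ℝ)) ^ k) *
        ‖kernel ℂ W 2 (fun i => ((![p₀, p₁] i, σ), i))‖ ≤ B k) :
    ∀ (k : ℕ) (q : Momentum), ‖iteratedFDeriv ℝ k
      (evalM (symInterp L (fun p => klLocSelfEnergyRe L M β U μ K n p - K.eval (latticeMomentum L p)))) q‖ ≤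
        2 * (Fintype.card P : ℝ) / (|β| * (L : ℝ) ^ 2) * B k := by
  intro k q
  have hfun : (fun p => klLocSelfEnergyRe L M β U μ K n p - K.eval (latticeMomentum L p)) =
      fun p => (∑ σ : Fin 2, ((selfEnergy L M β (ExteriorAlgebra.map (Matrix.toLin' (gridSubMatrix L M β x τ)) W) (omega0 M, p) σ).re +
        (selfEnergy L M β (ExteriorAlgebra.map (Matrix.toLin' (gridSubMatrix L M β x τ)) W) ((omega0 M).rev, p) σ).re)) / 4 := by
    funext p
    rw [klLocSelfEnergyRe_sub_frame_eq_locRe hβ U μ K n p, hW]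
  rw [hfun]
  rcases Nat.eq_zero_or_pos k with rfl | hkpos
  · refine (norm_iteratedFDeriv_zero_evalM_symInterp_le L _ q).trans ?_
    have h := sum_evenWeight_abs_torusCosCoeff_locRe_map_gridSub_le (L := L) (M := M) hβ x τ W (w := fun _ => (1 : ℝ))
      (fun _ => zero_le_one) (fun _ => rfl) (B := B 0) (fun σ p₀ => by simpa only [one_mul] using hB0 σ p₀)
    simpa only [one_mul] using h
  · refine (norm_iteratedFDeriv_evalM_symInterp_le_offZero_moments L _ hkpos q).trans ?_
    set w : TorusSite 2 L → ℝ := fun z =>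
      if z = 0 then (0 : ℝ) else (1 + ((z 0).valMinAbs.natAbs : ℝ) + ((z 1).valMinAbs.natAbs : ℝ)) ^ k with hw
    have hw0 : ∀ z, 0 ≤ w z := fun z => by rw [hw]; dsimp only; split_ifs <;> positivity
    have hweven : ∀ z, w (-z) = w z := fun z => by simp only [hw]; exact offDiagWeight_neg k z
    have h := sum_evenWeight_abs_torusCosCoeff_locRe_map_gridSub_le (L := L) (M := M) hβ x τ W hw0 hweven (B := B k)
      (fun σ p₀ => hBk k hkpos σ p₀)
    refine le_trans (le_of_eq ?_) h
    rw [sum_filter]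
    refine sum_congr rfl fun y _ => ?_
    simp only [hw]
    by_cases hy : y = 0
    · rw [if_neg (not_not.2 hy), if_pos hy, zero_mul]
    · rw [if_pos hy, if_neg hy]

end Model

/-! ## §2 The bare frame: no position kernel, no grid counterterm, the scale-`0` representation -/

/-- **The bare frame has no position kernel**: `Ǩ_L = 0` for `K = 0`. -/
@[simp] theorem framePosKernel_frameZero (z : TorusSite 2 L) : framePosKernel L (0 : TrigPolyC4v) z = 0 := by
  simp [framePosKernel]

/-- **The bare frame has no grid counterterm**: `𝒩_{0,N} = 0`. -/
@[simp] theorem hubbardGridCounterQuadratic_frameZero {N : ℕ} (β : ℝ) :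
    hubbardGridCounterQuadratic L N β (0 : TrigPolyC4v) = 0 := by
  simp [hubbardGridCounterQuadratic, framePosKernel_frameZero]

section Model

variable [NeZero M]

/-- **At the bare frame, `𝒱⁽⁰⁾ = map S_{4M} (effAction (S_{4M}ᵀ C⁰_{>e₀} S_{4M}) V_{4M})`** — p3's scale-`0` representation with both counterterms erased
(`counterQuadratic_zero`, `hubbardGridCounterQuadratic_frameZero`). -/
theorem klEffectiveAction_zero_frameZero_eq_map_gridSub {β : ℝ} (hβ : β ≠ 0) (U μ : ℝ) :
    klEffectiveAction L M β U μ 0 klE0 0 - counterQuadratic L M β 0 =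
      ExteriorAlgebra.map (Matrix.toLin' (gridSubMatrix L M β (fun p : GridPoint L (2 * (2 * M)) => p.2)
          (fun p => gridTime β (2 * (2 * M)) p.1)))
        (effAction ℂ ((hubbardGridSub L M β (2 * (2 * M))).transpose * hubbardCovAboveCT L M β μ 0 0 klE0 *
            hubbardGridSub L M β (2 * (2 * M)))
          (hubbardGridInteraction L (2 * (2 * M)) β U)) := by
  have h := klEffectiveAction_zero_sub_counterQuadratic_eq_map_gridSub (L := L) (M := M) hβ U μ 0
  simpa only [hubbardGridCounterQuadratic_frameZero, add_zero, sub_zero] using h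

/-- **THE SCALE-0, BARE-FRAME MOMENTUM SIZES FROM THE GRID, EVERY ORDER, representation discharged.**  With
`W₀ := effAction (S_{4M}ᵀ C⁰_{>e₀} S_{4M}) V_{4M}` (NO counterterm anywhere): if for both spins and every grid point `p₀`
`Σ_{p₁} ‖kernel W₀ 2 ((p₀,σ,+),(p₁,σ,−))‖ ≤ B 0` and the OFF-DIAGONAL weighted sums `Σ_{p₁} [x⃗₁ ≠ x⃗₀](1+|Δx̃₀|+|Δx̃₁|)ᵏ‖kernel W₀ 2 (…)‖ ≤ B k` (every
`k ≥ 1`), then for every `k` and `q`: `‖Dᵏ evalM (symInterp L (klLocSelfEnergyRe … 0 0)) q‖ ≤ (2·|GridPoint L 4M|/(|β|L²))·B k` — the GLOBAL sup-jets of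
the interpolated local self-energy at the bare frame (what the angular jets of `ν₀(0)` on the free Fermi curve are read from). -/
theorem twoLeg_momentumSizes_zero_frameZero_of_grid {β : ℝ} (hβ : β ≠ 0) (U μ : ℝ) {B : ℕ → ℝ}
    (hB0 : ∀ (σ : Fin 2) (p₀ : GridPoint L (2 * (2 * M))), ∑ p₁ : GridPoint L (2 * (2 * M)),
      ‖kernel ℂ
        (effAction ℂ ((hubbardGridSub L M β (2 * (2 * M))).transpose * hubbardCovAboveCT L M β μ 0 0 klE0 *
            hubbardGridSub L M β (2 * (2 * M))) (hubbardGridInteraction L (2 * (2 * M)) β U))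
        2 (fun i => ((![p₀, p₁] i, σ), i))‖ ≤ B 0)
    (hBk : ∀ k, 1 ≤ k → ∀ (σ : Fin 2) (p₀ : GridPoint L (2 * (2 * M))), ∑ p₁ : GridPoint L (2 * (2 * M)),
      (if p₁.2 - p₀.2 = 0 then (0 : ℝ) else
        (1 + (((p₁.2 - p₀.2) 0).valMinAbs.natAbs : ℝ) + (((p₁.2 - p₀.2) 1).valMinAbs.natAbs : ℝ)) ^ k) *
        ‖kernel ℂ
          (effAction ℂ ((hubbardGridSub L M β (2 * (2 * M))).transpose * hubbardCovAboveCT L M β μ 0 0 klE0 *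
              hubbardGridSub L M β (2 * (2 * M))) (hubbardGridInteraction L (2 * (2 * M)) β U))
          2 (fun i => ((![p₀, p₁] i, σ), i))‖ ≤ B k) :
    ∀ (k : ℕ) (q : Momentum), ‖iteratedFDeriv ℝ k (evalM (symInterp L (klLocSelfEnergyRe L M β U μ 0 0))) q‖ ≤
        2 * (Fintype.card (GridPoint L (2 * (2 * M))) : ℝ) / (|β| * (L : ℝ) ^ 2) * B k := by
  intro k q
  have h := twoLeg_sep_momentumSizes_of_grid_all (L := L) (M := M) hβ U μ 0 0 (fun p : GridPoint L (2 * (2 * M)) => p.2)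
    (fun p => gridTime β (2 * (2 * M)) p.1) _ (klEffectiveAction_zero_frameZero_eq_map_gridSub hβ U μ) hB0 hBk k q
  simpa only [TrigPolyC4v.eval_zero, sub_zero] using h

/-- **THE SCALE-0, BARE-FRAME (E3d) EXPORT FROM THE GRID**: if the temporal first moment of the two-leg kernel of
`W₀ = effAction (S_{4M}ᵀ C⁰_{>e₀} S_{4M}) V_{4M}` satisfies `Σ_{p₁} (β/4M)·circDist_{4M}(j₀,j₁)·‖kernel W₀ 2 ((p₀,σ,+),(p₁,σ,−))‖ ≤ Bᵗ` for both spins and every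
grid point, then `|klFieldStrength … 0 0 k⃗ − 1| ≤ (2·4M/β)·Bᵗ` at every torus momentum. -/
theorem abs_klFieldStrength_zero_frameZero_sub_one_le_of_grid_time_moment {β : ℝ} (hβ : 0 < β) (U μ : ℝ) (k : TorusSite 2 L) {B : ℝ}
    (hB : ∀ (σ : Fin 2) (p₀ : GridPoint L (2 * (2 * M))), ∑ p₁ : GridPoint L (2 * (2 * M)),
      β / ((2 * (2 * M) : ℕ) : ℝ) * (circDist (2 * (2 * M)) p₀.1.val p₁.1.val : ℝ) *
        ‖kernel ℂ
          (effAction ℂ ((hubbardGridSub L M β (2 * (2 * M))).transpose * hubbardCovAboveCT L M β μ 0 0 klE0 *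
              hubbardGridSub L M β (2 * (2 * M))) (hubbardGridInteraction L (2 * (2 * M)) β U)) 2
          (fun i => ((![p₀, p₁] i, σ), i))‖ ≤ B) :
    |klFieldStrength L M β U μ 0 0 k - 1| ≤ 2 * ((2 * (2 * M) : ℕ) : ℝ) / β * B := by
  have h := abs_klFieldStrength_zero_sub_one_le_of_grid_time_moment (L := L) (M := M) hβ U μ 0 k (B := B)
  simp only [hubbardGridCounterQuadratic_frameZero, add_zero] at h
  exact h hB

end Model

end Summit.HubbardSuperconductivity.HubbardSuperconductivity.Theorems.TwoLegFourier

end
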